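import Summits.BirchSwinnertonDyer.BirchSwinnertonDyer.Theorems.GenusKolyvaginAtTwoMinimalTwinBSDTwoTranspositionDoor
import Summits.BirchSwinnertonDyer.BirchSwinnertonDyer.Theorems.GenusKolyvaginAtTwoMinimalTwinBSDTwoSwappedPairOneBitPrime
import Summits.BirchSwinnertonDyer.BirchSwinnertonDyer.Theorems.GenusKolyvaginAtTwoGenusPrimitiveSupplyAtTwoTwistingPrime
import Literature.NumberTheory.EllipticCurves.GlobalMinimalModelProofs
import Literature.NumberTheory.EllipticCurves.BSDRankZeroDensityProofs
import Literature.NumberTheory.EllipticCurves.TwoAdicImageSurjectivityModTwoProofs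
import HarnessLib

/-!
# Route `GenusKolyvaginAtTwo`, crux U₂ `MinimalTwinBSDTwo` (stmt-BirchSwinnertonDyer-22985), LINE 23 «twin_swap», cell hTw1 (`Δ < 0`):
# DOOR-OPEN PRIME HEEGNER FIELDS EXIST BEYOND EVERY BOUND — NV⁻'s Čebotarev class is PROVED infinite (unconditionally),
# and carries a `2`-Selmer-TRIVIAL twin costing exactly one Tamagawa bit

Seat `bsd-line-gk2-p2` g25 (PROVER seat 2/3, cell `bsd-f1-sign2`; LINE 23 holder), `--supports stmt-BirchSwinnertonDyer-22985` (helper;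
closes nothing).  THEOREMS ONLY (no definition, no named fact, no `sorry`); standard axioms.  **BSD is NOT proved by this file; U₂ / the
wall / NV / EXP / S_id are NOT proved; no item is closed.**

THE POINT (planner currency).  gk2-p3 g29 split the reversed supply of the `Δ < 0` cell hTw1 of U₂ into NV⁻ («some prime `ℓ ≡ 7 (8)` with
`−ℓ` Heegner for `N_W` and the door OPEN at `ℓ` — `Sel₂(W) ⊄ strictLocalKer_ℓ` — has `L(W^{(−ℓ)},1) ≠ 0») and EXP⁻, and recorded as UNTRIED
(FINAL 13:13Z, «sized L») the NON-VACUITY of NV⁻'s class.  It is a THEOREM already in the tree, in the currency of the rank-0 side: the LEAD's /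
gk2-p4's MAZUR–RUBIN TWISTING PRIMES AT `2` (`GenusKolyTwistingPrime.exists_twistingPrime_not_selmerGroup_le_strictLocalKer`: Čebotarev in
`ℚ(E[2], μ_{8N}, ·)` via the tree's proved `absoluteGaloisGroup.frobenius_dense`, for ANY `W` with `Δ_W < 0`, `ρ̄_{W,2}` onto and `Sel₂(W) ≠ 0` —
no rank hypothesis), gk2-p5's `GenusKolyTwin.exists_heegnerField_of_prime` (the field `ℚ(√−ℓ)` with every K-clause), and gk2-p3's own DOWN door
`TwinSwap.Door.natCard_selmerGroup_twin_eq_one_of_not_strict`.  This file is the by-name dictionary: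

* §1 `exists_doorOpen_prime` — `Δ_W < 0`, `ρ̄_{W,2}` onto, `#Sel₂(W) ≠ 1`, any bound `b`: a prime `ℓ > b`, `ℓ ≡ 7 (8)`, `ℓ ∤ N_W`,
  `ℓ ≡ −1 (mod p)` for every odd `p ∣ N_W`, with `¬ Sel₂(W) ≤ strictLocalKer W ℚ_ℓ 2`.
* §2 **`exists_doorOpen_prime_heegnerField_selmerTrivialTwin`** — for `#Sel₂(W) = 2` in addition: `K = ℚ(√−ℓ)` imaginary quadratic, `d_K = −ℓ`
  odd `≠ −3`, Heegner for `N_W`, `2` split, the two non-square clauses, AND a globally minimal twin `Wd ≅ W^{(−ℓ)}` with **`#Sel₂(Wd) = 1`** and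
  **`ord₂ C(Wd) = ord₂ C(W) + 1`** (the transposition prime costs exactly one bit, gk2-p3 `…OneBitPrime`).  UNCONDITIONAL: no rank, no `L`-value,
  no named fact — the ALGEBRAIC half of the reversed depth-one supply S2⁻ is free on (Δ < 0, ♯).
* §3 `doorClass_inhabited_sharp` — the conclusion of gk2-p3's `hNVneg` (p773745 `analyticDoorSupply_of_nonvanishing_of_exponent`) with its LAST
  conjunct `L(W^{(d_K)},1) ≠ 0` DROPPED holds for every `W` with `Δ_W < 0`, `ρ̄_{W,2}` onto, `#Sel₂(W) = 2`: NV⁻'s class is inhabited (beyond every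
  bound, §1), so on ♯ **NV⁻ is a pure central-value statement over a PROVED-infinite Čebotarev class — exactly like NV⁺** (`exists_silent_prime_heegnerField`).

* §4 (v2) `hasSurjectiveModNGaloisRep_two_of_negDisc_of_natCard_selmerGroup_eq_two`, **`doorClass_inhabited_of_GZK`**,
  `doorOpen_selmerTrivialTwin_hTw1_of_GZK` — on NV⁻'s OWN binders (non-CM, `r_an = 1`, `#Sel₂ = 2`, `Δ < 0`, `ord₂ C = 1`; NO image
  hypothesis) the ♯ hypothesis is AUTOMATIC modulo GZK only (`r_an = 1 ⟹ r_MW = 1 ⟹ E(ℚ)[2] = 0` by the descent count, and `Δ < 0` is not a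
  square ⟹ `ρ̄_{W,2}` onto, Dokchitser–Dokchitser (1)), so NV⁻'s class is inhabited VERBATIM on gk2-p3's text, mod the route's print item 19921.

Honest framing: KNOWN in print (Mazur–Rubin 2010 Prop. 3.3 / Cor. 3.4 (i) / Lemma 3.5 at `p = 2` over `ℚ`; Gross 1991 §1); kernel assembly of tree
theorems; beyond-print theorem: no.  The `L`-value clause NV⁻ and the exponent clause EXP⁻ are untouched and remain OPEN.

References: [MazurRubin2010] Prop. 3.3, Cor. 3.4 (i), Lemma 3.5; [GrossLMS1991] §1 (p. 235), §9 Prop. 9.6; [Kramer1981] §2 Prop. 3, Thm. 1;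
[SilvermanAEC2009] VIII.8 Cor. 8.3, X.4.2.
-/

set_option autoImplicit false
set_option linter.dupNamespace false -- `Summit.<P>.<Sub>` repeats `BirchSwinnertonDyer` (D-0017)

noncomputable section

open scoped Classical

open NumberField WeierstrassCurve Literature.NumberTheory.EllipticCurves Literature.NumberTheory.GaloisRepresentations
open Summit.BirchSwinnertonDyer.BirchSwinnertonDyer.Theorems.GenusKolyTwistingPrime (exists_twistingPrime_not_selmerGroup_le_strictLocalKer)
open Summit.BirchSwinnertonDyer.BirchSwinnertonDyer.Theorems.GenusKolyTwin (exists_heegnerField_of_prime)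
open Summit.BirchSwinnertonDyer.BirchSwinnertonDyer.Theorems.GenusExact.TwinSwap.Door (natCard_selmerGroup_twin_eq_one_of_not_strict)
open Summit.BirchSwinnertonDyer.BirchSwinnertonDyer.Theorems.GenusExact.TwinSwap.OneBit
  (padicValNat_two_tamagawaProduct_twin_eq_succ_of_discr_eq_neg_prime)

namespace Summit.BirchSwinnertonDyer.BirchSwinnertonDyer.Theorems.GenusExact.TwinSwap.DoorOpen

variable (W : WeierstrassCurve ℚ) [W.IsElliptic]

/-! ## §1 Door-open twisting primes in the Heegner progression (no rank hypothesis) -/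

/-- **Door-open primes in the prime-Heegner progression exist beyond every bound.**  `W/ℚ` elliptic with `Δ_W < 0`, `ρ̄_{W,2}` onto and
`#Sel₂(W) ≠ 1`; `b` any bound.  Then there is a prime `ℓ > b` with `ℓ ≡ 7 (mod 8)`, `ℓ ∤ N_W`, `ℓ ≡ −1 (mod p)` for every odd prime
`p ∣ N_W`, at which `Sel₂(W)` is NOT contained in the strict local kernel (`loc_ℓ` of some Selmer class is non-zero — the door is OPEN).
The LEAD's Mazur–Rubin twisting prime (`exists_twistingPrime_not_selmerGroup_le_strictLocalKer`, Čebotarev proved in the tree) read in the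
congruence currency of `GenusKolyTwin.exists_heegnerField_of_prime`.
[cite: MazurRubin2010, Prop. 3.3 and Lemma 3.5] [cite: GrossLMS1991, §9 Prop. 9.6] -/
theorem exists_doorOpen_prime (hΔ : W.Δ < 0) (hsurj : W.HasSurjectiveModNGaloisRep 2)
    (hSel : Nat.card (W.selmerGroup 2) ≠ 1) (b : ℕ) :
    ∃ (ℓ : ℕ) (_ : Fact ℓ.Prime), b < ℓ ∧ ℓ % 8 = 7 ∧ ¬ ℓ ∣ W.conductorNorm ℤ ∧
      (∀ p : ℕ, p.Prime → p ∣ W.conductorNorm ℤ → p ≠ 2 → (ℓ : ZMod p) = -1) ∧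
      ¬ W.selmerGroup 2 ≤ MazurRubin2010.strictLocalKer W ℚ_[ℓ] 2 := by
  have hN : W.conductorNorm ℤ ≠ 0 := (W.conductorNorm_pos_holds).ne'
  obtain ⟨ℓ, hℓF, hbℓ, hℓN, hℓ8, hℓp, hns⟩ :=
    exists_twistingPrime_not_selmerGroup_le_strictLocalKer W hsurj hΔ hSel hN b
  refine ⟨ℓ, hℓF, hbℓ, hℓ8, fun h ↦ hℓN (h.mul_left 2), fun p _ hp _ ↦ ?_, hns⟩
  have h : ((ℓ + 1 : ℕ) : ZMod p) = 0 := (ZMod.natCast_eq_zero_iff _ _).mpr (hℓp p hp)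
  rw [Nat.cast_add, Nat.cast_one] at h
  exact eq_neg_of_add_eq_zero_left h

/-! ## §2 The door-open prime Heegner field with its `2`-Selmer-trivial twin (one Tamagawa bit) -/

/-- **REVERSED `2`-SELMER-TRIVIAL PRIME-HEEGNER TWIN SUPPLY ON `Δ < 0` — UNCONDITIONAL.**  `W/ℚ` globally minimal elliptic with `Δ_W < 0`,
`ρ̄_{W,2}` onto and `#Sel₂(W) = 2`; `b` any bound.  Then there are a prime `ℓ > b`, `ℓ ≡ 7 (mod 8)`, `ℓ ∤ N_W`, at which the door of
`Sel₂(W)` is OPEN (`¬ Sel₂(W) ≤ strictLocalKer_ℓ`), the Heegner field `K = ℚ(√−ℓ)` (imaginary quadratic, `d_K = −ℓ` odd `≠ −3`, Heegner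
for `N_W`, `2` split, `d_K·(−|Δ_W|)` and `d_K·(−2|Δ_W|)` non-squares), and a GLOBALLY MINIMAL twin `Wd ≅ W^{(d_K)}` with
**`#Sel₂(Wd) = 1`** (gk2-p3's DOWN door, Mazur–Rubin Cor. 3.4 (i) at `T = {ℓ}`) and **`ord₂ C(Wd) = ord₂ C(W) + 1`** (`ℓ` is a transposition
prime).  No rank, no `L`-value, no named fact.  [cite: MazurRubin2010, Prop. 3.3, Cor. 3.4 (i), Lemma 3.5] [cite: GrossLMS1991, §1 (p. 235)]
[cite: Kramer1981, §2 Prop. 3] -/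
theorem exists_doorOpen_prime_heegnerField_selmerTrivialTwin [W.IsGloballyMinimal] (hΔ : W.Δ < 0)
    (hsurj : W.HasSurjectiveModNGaloisRep 2) (hSel : Nat.card (W.selmerGroup 2) = 2) (b : ℕ) :
    ∃ (ℓ : ℕ) (_ : Fact ℓ.Prime), b < ℓ ∧ ℓ % 8 = 7 ∧ ¬ ℓ ∣ W.conductorNorm ℤ ∧
      ¬ W.selmerGroup 2 ≤ MazurRubin2010.strictLocalKer W ℚ_[ℓ] 2 ∧
      ∃ (K : Type) (_ : Field K) (_ : NumberField K), IsImaginaryQuadratic K ∧ discr K = -(ℓ : ℤ) ∧ Odd (discr K) ∧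
        discr K ≠ -3 ∧ SatisfiesHeegnerHypothesis (W.conductorNorm ℤ) K ∧
        ((Ideal.span {(2 : ℤ)}).primesOver (𝓞 K)).ncard = 2 ∧
        ¬ IsSquare ((discr K : ℚ) * -|W.Δ|) ∧ ¬ IsSquare ((discr K : ℚ) * (-(2 * |W.Δ|))) ∧
        ∃ (Wd : WeierstrassCurve ℚ) (_ : Wd.IsElliptic) (_ : Wd.IsGloballyMinimal),
          (∃ C : VariableChange ℚ, C • W.quadraticTwist (discr K : ℚ) = Wd) ∧
          Nat.card (Wd.selmerGroup 2) = 1 ∧ padicValNat 2 Wd.tamagawaProduct = padicValNat 2 W.tamagawaProduct + 1 := by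
  obtain ⟨ℓ, hℓF, hbℓ, hℓ8, hℓN, hℓp, hns⟩ := exists_doorOpen_prime W hΔ hsurj (by rw [hSel]; decide) b
  have hℓ : ℓ.Prime := hℓF.out
  obtain ⟨-, -, K, _, _, hK, hd, hodd, hd3, hH, h2K, hsq1, hsq2⟩ := exists_heegnerField_of_prime W hℓ hℓ8 hℓp
  -- a globally minimal model of the twist
  have hd0 : ((discr K : ℤ) : ℚ) ≠ 0 := by exact_mod_cast NumberField.discr_ne_zero K
  haveI := W.isElliptic_quadraticTwist hd0
  obtain ⟨C, hC⟩ := hasGlobalMinimalModel_rat_holds (W.quadraticTwist ((discr K : ℤ) : ℚ))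
  haveI := hC
  refine ⟨ℓ, hℓF, hbℓ, hℓ8, hℓN, hns, K, inferInstance, inferInstance, hK, hd, hodd, hd3, hH, h2K, hsq1, hsq2,
    C • W.quadraticTwist ((discr K : ℤ) : ℚ), inferInstance, hC, ⟨C, rfl⟩, ?_, ?_⟩
  · exact natCard_selmerGroup_twin_eq_one_of_not_strict W hΔ hSel hK hodd hH h2K hd _ ⟨C, rfl⟩ hns
  · exact padicValNat_two_tamagawaProduct_twin_eq_succ_of_discr_eq_neg_prime W hK hodd hH hℓ hd hΔ C rfl

/-- **On the cell hTw1 (`Δ < 0`, `ord₂ C(W) = 1`) the supplied twin has `ord₂ C(Wd) = 2`** — the one-bit budget of S2⁻ / S1⁻ (`…AnalyticSplit`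
`hS1neg`: rank `0`, `#Sel₂ = 1`, `Δ < 0`, `ord₂ C = 2`) is met automatically.  [cite: Kramer1981, §2 Prop. 3] [cite: MazurRubin2010, Cor. 3.4 (i)] -/
theorem exists_doorOpen_prime_heegnerField_selmerTrivialTwin_hTw1 [W.IsGloballyMinimal] (hΔ : W.Δ < 0)
    (hsurj : W.HasSurjectiveModNGaloisRep 2) (hSel : Nat.card (W.selmerGroup 2) = 2)
    (hC1 : padicValNat 2 W.tamagawaProduct = 1) (b : ℕ) :
    ∃ (ℓ : ℕ) (_ : Fact ℓ.Prime), b < ℓ ∧ ℓ % 8 = 7 ∧ ¬ ℓ ∣ W.conductorNorm ℤ ∧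
      ¬ W.selmerGroup 2 ≤ MazurRubin2010.strictLocalKer W ℚ_[ℓ] 2 ∧
      ∃ (K : Type) (_ : Field K) (_ : NumberField K), IsImaginaryQuadratic K ∧ discr K = -(ℓ : ℤ) ∧ Odd (discr K) ∧
        discr K ≠ -3 ∧ SatisfiesHeegnerHypothesis (W.conductorNorm ℤ) K ∧
        ((Ideal.span {(2 : ℤ)}).primesOver (𝓞 K)).ncard = 2 ∧
        ∃ (Wd : WeierstrassCurve ℚ) (_ : Wd.IsElliptic) (_ : Wd.IsGloballyMinimal),
          (∃ C : VariableChange ℚ, C • W.quadraticTwist (discr K : ℚ) = Wd) ∧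
          Nat.card (Wd.selmerGroup 2) = 1 ∧ W.Δ < 0 ∧ padicValNat 2 Wd.tamagawaProduct = 2 := by
  obtain ⟨ℓ, hℓF, hbℓ, hℓ8, hℓN, hns, K, _, _, hK, hd, hodd, hd3, hH, h2K, -, -, Wd, _, _, hWd, hSel1, hTam⟩ :=
    exists_doorOpen_prime_heegnerField_selmerTrivialTwin W hΔ hsurj hSel b
  exact ⟨ℓ, hℓF, hbℓ, hℓ8, hℓN, hns, K, inferInstance, inferInstance, hK, hd, hodd, hd3, hH, h2K, Wd, inferInstance, inferInstance,
    hWd, hSel1, hΔ, by rw [hTam, hC1]⟩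

/-! ## §3 NV⁻'s class is inhabited (gk2-p3's `hNVneg` text with the `L`-value conjunct dropped), on ♯ -/

/-- **NV⁻'S ČEBOTAREV CLASS IS INHABITED ON ♯.**  For every `W/ℚ` globally minimal elliptic with `Δ_W < 0`, `ρ̄_{W,2}` onto and
`#Sel₂(W) = 2` — in particular on the ♯-cell hTw1 of U₂ where `closes` consumes it (non-CM, `r_an = 1`, `#Sel₂ = 2`, `Δ < 0`, `ord₂ C = 1`,
surjective `2`-adic image) — the conclusion of gk2-p3's NV⁻ (`…AnalyticSplit.analyticDoorSupply_of_nonvanishing_of_exponent`, binder `hNVneg`)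
WITHOUT its last conjunct `(W.quadraticTwist d_K).entireLFunction 1 ≠ 0` HOLDS: an imaginary quadratic `K` with `d_K = −ℓ`, `ℓ` a prime with the
door of `Sel₂(W)` open at `ℓ`, `d_K` odd `≠ −3`, Heegner for `N_W`, `2` split.  So NV⁻ on ♯ asserts ONLY a central value: «not every prime of this
(proved infinite, §1) class has `L(W^{(−ℓ)}, 1) = 0`» — the exact analogue of NV⁺ over `GenusKolyTwin.exists_silent_prime_heegnerField`.
Unconditional; proves nothing about BSD; closes nothing.  [cite: MazurRubin2010, Prop. 3.3, Lemma 3.5] [cite: GrossLMS1991, §1 (p. 235)] -/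
theorem doorClass_inhabited_sharp :
    ∀ (W : WeierstrassCurve ℚ) [W.IsElliptic] [W.IsGloballyMinimal],
      W.Δ < 0 → W.HasSurjectiveModNGaloisRep 2 → Nat.card (W.selmerGroup 2) = 2 →
      ∃ (K : Type) (_ : Field K) (_ : NumberField K),
        IsImaginaryQuadratic K ∧
        (∃ (ℓ : ℕ) (_ : Fact ℓ.Prime), NumberField.discr K = -(ℓ : ℤ) ∧
          ¬ W.selmerGroup 2 ≤ MazurRubin2010.strictLocalKer W ℚ_[ℓ] 2) ∧
        Odd (NumberField.discr K) ∧ NumberField.discr K ≠ -3 ∧ SatisfiesHeegnerHypothesis (W.conductorNorm ℤ) K ∧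
        ((Ideal.span {(2 : ℤ)}).primesOver (𝓞 K)).ncard = 2 := by
  intro W _ _ hΔ hsurj hSel
  obtain ⟨ℓ, hℓF, -, -, -, hns, K, _, _, hK, hd, hodd, hd3, hH, h2K, -⟩ :=
    exists_doorOpen_prime_heegnerField_selmerTrivialTwin W hΔ hsurj hSel 0
  exact ⟨K, inferInstance, inferInstance, hK, ⟨ℓ, hℓF, hd, hns⟩, hodd, hd3, hH, h2K⟩

/-- **The same beyond every bound** (the class is infinite): for every `b` the field may be taken with `|d_K| = ℓ > b`.
[cite: MazurRubin2010, Prop. 3.3, Lemma 3.5] [cite: GrossLMS1991, §1 (p. 235)] -/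
theorem doorClass_inhabited_sharp_gt (b : ℕ) :
    ∀ (W : WeierstrassCurve ℚ) [W.IsElliptic] [W.IsGloballyMinimal],
      W.Δ < 0 → W.HasSurjectiveModNGaloisRep 2 → Nat.card (W.selmerGroup 2) = 2 →
      ∃ (K : Type) (_ : Field K) (_ : NumberField K),
        IsImaginaryQuadratic K ∧
        (∃ (ℓ : ℕ) (_ : Fact ℓ.Prime), b < ℓ ∧ NumberField.discr K = -(ℓ : ℤ) ∧
          ¬ W.selmerGroup 2 ≤ MazurRubin2010.strictLocalKer W ℚ_[ℓ] 2) ∧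
        Odd (NumberField.discr K) ∧ NumberField.discr K ≠ -3 ∧ SatisfiesHeegnerHypothesis (W.conductorNorm ℤ) K ∧
        ((Ideal.span {(2 : ℤ)}).primesOver (𝓞 K)).ncard = 2 := by
  intro W _ _ hΔ hsurj hSel
  obtain ⟨ℓ, hℓF, hbℓ, -, -, hns, K, _, _, hK, hd, hodd, hd3, hH, h2K, -⟩ :=
    exists_doorOpen_prime_heegnerField_selmerTrivialTwin W hΔ hsurj hSel b
  exact ⟨K, inferInstance, inferInstance, hK, ⟨ℓ, hℓF, hbℓ, hd, hns⟩, hodd, hd3, hH, h2K⟩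

/-! ## §4 (v2) On NV⁻'s own binders: the ♯ hypothesis is automatic on hTw1 (mod GZK), so the class is inhabited there verbatim -/

/-- **`ρ̄_{W,2}` is onto for `Δ_W < 0`, `#Sel₂(W) = 2`, `rank W(ℚ) = 1`** (unconditional).  The descent count `#Sel₂ = 2^{rank}·#E(ℚ)[2]·#Ш[2]`
(Silverman X.4.2; Literature `WeierstrassCurve.natCard_selmerGroup_eq`, as in `MinimalTwinBSDTwo.natCard_torsionBy_eq_one_and_natCard_shaTwo_eq_one`) gives `E(ℚ)[2] = 0`; `Δ < 0` is
not a square; Dokchitser–Dokchitser (1) (`hasSurjectiveModNGaloisRep_two_iff`, proved in the tree).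
[cite: SilvermanAEC2009, Thm. X.4.2(a)] [cite: DokchitserDokchitserMathZ2012, Theorem (1)] -/
theorem hasSurjectiveModNGaloisRep_two_of_negDisc_of_natCard_selmerGroup_eq_two (hΔ : W.Δ < 0)
    (hSel : Nat.card (W.selmerGroup 2) = 2) (hrank : W.mordellWeilRank = 1) : W.HasSurjectiveModNGaloisRep 2 := by
  -- descent count `#Sel₂ = 2^{rank} · #E(ℚ)[2] · #Ш[2]` (Silverman X.4.2): `2 = 2 · #E(ℚ)[2] · #Ш[2]`
  have hcard := W.natCard_selmerGroup_eq (n := 2) two_ne_zero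
  simp only [Nat.cast_ofNat] at hcard
  rw [hSel, hrank, pow_one, mul_assoc] at hcard
  have h : Nat.card (AddSubgroup.torsionBy W.toAffine.Point (2 : ℤ)) *
      Nat.card (W.sha ⊓ AddSubgroup.torsionBy W.galH1 (2 : ℤ) : AddSubgroup W.galH1) = 1 :=
    Nat.eq_of_mul_eq_mul_left two_pos (by rw [mul_one]; convert hcard.symm)
  have hbot : AddSubgroup.torsionBy W.toAffine.Point (2 : ℤ) = ⊥ :=
    AddSubgroup.eq_bot_of_card_eq _ (Nat.eq_one_of_mul_eq_one_right h)
  refine (hasSurjectiveModNGaloisRep_two_iff W).mpr ⟨fun P hP ↦ ?_, fun ⟨r, hr⟩ ↦ absurd hΔ (not_lt.mpr (hr ▸ mul_self_nonneg r))⟩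
  have hmem : P ∈ AddSubgroup.torsionBy W.toAffine.Point (2 : ℤ) :=
    (AddSubgroup.torsionBy.nsmul_iff (n := 2)).mpr (by convert hP)
  rw [hbot] at hmem
  exact AddSubgroup.mem_bot.mp hmem

/-- **NV⁻'S CLASS IS INHABITED ON NV⁻'S OWN BINDERS, modulo GZK only.**  `hGZK` = the route's print item 19921 `MultPublishedInputsAtTwo`
(`r_an ≤ 1 ⟹ r_MW = r_an`).  For every `W` with the binders of gk2-p3's `hNVneg` (non-CM, `r_an = 1`, `#Sel₂ = 2`, `Δ < 0`, `ord₂ C = 1` — the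
first, second and last are not even used beyond `r_an = 1`) the conclusion of `hNVneg` WITHOUT its `L`-value conjunct holds: `ρ̄_{W,2}` is onto by the
previous theorem, then §3.  So the only content of NV⁻ is the central value `L(W^{(−ℓ)},1) ≠ 0` at ONE prime of a proved-infinite class.
Proves nothing about BSD; closes nothing.  [cite: MazurRubin2010, Prop. 3.3, Lemma 3.5] [cite: DokchitserDokchitserMathZ2012, Theorem (1)]
[cite: GrossLMS1991, §1 (p. 235)] -/
theorem doorClass_inhabited_of_GZK (hGZK : rank_eq_analyticRank_of_analyticRank_le_one) :
    ∀ (W : WeierstrassCurve ℚ) [W.IsElliptic] [W.IsGloballyMinimal] [NeZero (W.conductorNorm ℤ)],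
      ¬ W.HasCM → W.analyticRank = 1 → Nat.card (W.selmerGroup 2) = 2 → W.Δ < 0 → padicValNat 2 W.tamagawaProduct = 1 →
      ∃ (K : Type) (_ : Field K) (_ : NumberField K),
        IsImaginaryQuadratic K ∧
        (∃ (ℓ : ℕ) (_ : Fact ℓ.Prime), NumberField.discr K = -(ℓ : ℤ) ∧
          ¬ W.selmerGroup 2 ≤ MazurRubin2010.strictLocalKer W ℚ_[ℓ] 2) ∧
        Odd (NumberField.discr K) ∧ NumberField.discr K ≠ -3 ∧ SatisfiesHeegnerHypothesis (W.conductorNorm ℤ) K ∧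
        ((Ideal.span {(2 : ℤ)}).primesOver (𝓞 K)).ncard = 2 := by
  intro W _ _ _ _ hr hSel hΔ _
  have hrk : W.mordellWeilRank = 1 := by rw [(hGZK W (le_of_eq hr)).1, hr]
  exact doorClass_inhabited_sharp W hΔ (hasSurjectiveModNGaloisRep_two_of_negDisc_of_natCard_selmerGroup_eq_two W hΔ hSel hrk) hSel

/-- **The door-open `2`-Selmer-trivial twin on hTw1, on NV⁻'s own binders, modulo GZK only, beyond every bound** — §2's
`exists_doorOpen_prime_heegnerField_selmerTrivialTwin_hTw1` with the ♯ hypothesis discharged: a prime `ℓ > b`, `ℓ ≡ 7 (8)`, `ℓ ∤ N_W`, the door of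
`Sel₂(W)` open at `ℓ`, `K = ℚ(√−ℓ)` with every K-clause, and a globally minimal twin `Wd ≅ W^{(−ℓ)}` with `#Sel₂(Wd) = 1`, `ord₂ C(Wd) = 2` — the
complete NON-analytic half of S2⁻ (everything except «`P(1)` of infinite order» = NV⁻ and the exponent = EXP⁻).  Proves nothing about BSD; closes
nothing.  [cite: MazurRubin2010, Prop. 3.3, Cor. 3.4 (i), Lemma 3.5] [cite: Kramer1981, §2 Prop. 3] [cite: GrossLMS1991, §1 (p. 235)] -/
theorem doorOpen_selmerTrivialTwin_hTw1_of_GZK (hGZK : rank_eq_analyticRank_of_analyticRank_le_one) (b : ℕ) :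
    ∀ (W : WeierstrassCurve ℚ) [W.IsElliptic] [W.IsGloballyMinimal] [NeZero (W.conductorNorm ℤ)],
      ¬ W.HasCM → W.analyticRank = 1 → Nat.card (W.selmerGroup 2) = 2 → W.Δ < 0 → padicValNat 2 W.tamagawaProduct = 1 →
      ∃ (ℓ : ℕ) (_ : Fact ℓ.Prime), b < ℓ ∧ ℓ % 8 = 7 ∧ ¬ ℓ ∣ W.conductorNorm ℤ ∧
        ¬ W.selmerGroup 2 ≤ MazurRubin2010.strictLocalKer W ℚ_[ℓ] 2 ∧
        ∃ (K : Type) (_ : Field K) (_ : NumberField K), IsImaginaryQuadratic K ∧ discr K = -(ℓ : ℤ) ∧ Odd (discr K) ∧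
          discr K ≠ -3 ∧ SatisfiesHeegnerHypothesis (W.conductorNorm ℤ) K ∧
          ((Ideal.span {(2 : ℤ)}).primesOver (𝓞 K)).ncard = 2 ∧
          ∃ (Wd : WeierstrassCurve ℚ) (_ : Wd.IsElliptic) (_ : Wd.IsGloballyMinimal),
            (∃ C : VariableChange ℚ, C • W.quadraticTwist (discr K : ℚ) = Wd) ∧
            Nat.card (Wd.selmerGroup 2) = 1 ∧ W.Δ < 0 ∧ padicValNat 2 Wd.tamagawaProduct = 2 := by
  intro W _ _ _ _ hr hSel hΔ hC1
  have hrk : W.mordellWeilRank = 1 := by rw [(hGZK W (le_of_eq hr)).1, hr]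
  exact exists_doorOpen_prime_heegnerField_selmerTrivialTwin_hTw1 W hΔ
    (hasSurjectiveModNGaloisRep_two_of_negDisc_of_natCard_selmerGroup_eq_two W hΔ hSel hrk) hSel hC1 b

end Summit.BirchSwinnertonDyer.BirchSwinnertonDyer.Theorems.GenusExact.TwinSwap.DoorOpen

end
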